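import Summits.HubbardSuperconductivity.HubbardSuperconductivity.Theorems.AnisotropyChordTransferFsumIdentity

/-!
# Route `AnisotropyChord` / H0 rotor rung, route (1): the GROUND-STATE DIRICHLET FORM — the energy excess of a diagonally dressed
# Perron amplitude is a bond sum (theory seat `hubbard-h0-rotor-theory-1` g12, memo ROTOR-THEORY-12 §184(n) «Ground-state (Doob/Dirichlet)
# identity for diagonal g and Hu = Eu»; prover seat `hubbard-h0-rotor-p1` g15)

`fsumC_eq_bond_sum` (`…TransferFsumIdentity`) is the case `g = cosWave` of a general identity: for the Perron amplitude `a` of a sector of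
`H(Δ)` and ANY real diagonal dressing `g`,

  `⟨g a, (H − E(M)) g a⟩ = ⅛ Σ_x Σ_y [x ∼ y] Σ_σ a(σ) a(σ ∘ swap x y) (g(σ) − g(σ ∘ swap x y))²`

(`energyExcess_diag_eq_bond_sum`; the `Sᶻ`-basis Dirichlet form of the ground-state-transformed (Doob) exclusion chain — the double
commutator `½⟨a, [g, [H, g]] a⟩` bond by bond).  Consequences: the excess is `≥ 0` (`energyExcess_diag_nonneg`) and is bounded by any bondwise
Lipschitz bound of `g` against the exchange correlation (`energyExcess_diag_le_of_lipschitz`: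
`(∀ bonds, (g σ − g σ')² ≤ δ²) ⇒ excess ≤ ⅛ δ² Σ_{x∼y} hopCorr a x y`).  This is the tool for variational UPPER bounds on sector gaps with
translation-invariant diagonal trial states (two-phonon `|ρ_k|²·a`, the domain-edge computation of §184(n)). All folklore.
-/

set_option linter.dupNamespace false
set_option autoImplicit false

noncomputable section

open Finset Filter Topology
open Literature.MathematicalPhysics.QuantumLattice Literature.Probability.LatticeModels
open Summit.HubbardSuperconductivity.HubbardSuperconductivity.Theorems.AnisotropyChord.InsertionEntropy
open Summit.HubbardSuperconductivity.HubbardSuperconductivity.Theorems.AnisotropyChord.Tower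

namespace Summit.HubbardSuperconductivity.HubbardSuperconductivity.Theorems.AnisotropyChord.Transfer

variable {L : ℕ} [NeZero L]

/-- the symmetrised bond term for a general diagonal dressing:
`Σ_σ g(σ) a(σ) a(σ') (g(σ) − g(σ')) = ½ Σ_σ a(σ) a(σ') (g(σ) − g(σ'))²`, `σ' = σ ∘ swap x y` (the involution `σ ↦ σ'`). [folklore] -/
theorem sum_diag_hop_eq (g a : TensorIndex (TorusSite 2 L) 2 → ℝ) (x y : TorusSite 2 L) :
    ∑ σ, g σ * a σ * a (σ ∘ ⇑(Equiv.swap x y)) * (g σ - g (σ ∘ ⇑(Equiv.swap x y)))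
      = (1/2 : ℝ) * ∑ σ, a σ * a (σ ∘ ⇑(Equiv.swap x y)) * (g σ - g (σ ∘ ⇑(Equiv.swap x y))) ^ 2 := by
  set f : TensorIndex (TorusSite 2 L) 2 → ℝ := fun σ =>
    g σ * a σ * a (σ ∘ ⇑(Equiv.swap x y)) * (g σ - g (σ ∘ ⇑(Equiv.swap x y))) with hf
  have hinv : ∀ σ : TensorIndex (TorusSite 2 L) 2, (σ ∘ ⇑(Equiv.swap x y)) ∘ ⇑(Equiv.swap x y) = σ := by
    intro σ; funext z; simp [Equiv.swap_apply_self]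
  have hbij : Function.Bijective (fun σ : TensorIndex (TorusSite 2 L) 2 => σ ∘ ⇑(Equiv.swap x y)) :=
    ⟨fun σ τ h => by simpa [hinv] using congrArg (fun ν => ν ∘ ⇑(Equiv.swap x y)) h, fun τ => ⟨_, hinv τ⟩⟩
  have hsum : ∑ σ, f σ = ∑ σ, f (σ ∘ ⇑(Equiv.swap x y)) := (hbij.sum_comp f).symm
  have h2 : 2 * ∑ σ, f σ = ∑ σ, (f σ + f (σ ∘ ⇑(Equiv.swap x y))) := by
    rw [two_mul, Finset.sum_add_distrib, ← hsum]
  have h3 : ∑ σ, (f σ + f (σ ∘ ⇑(Equiv.swap x y)))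
      = ∑ σ, a σ * a (σ ∘ ⇑(Equiv.swap x y)) * (g σ - g (σ ∘ ⇑(Equiv.swap x y))) ^ 2 := by
    refine Finset.sum_congr rfl fun σ _ => ?_
    simp only [hf, hinv]; ring
  show ∑ σ, f σ = _
  linarith [h2, h3]

/-- **THE GROUND-STATE DIRICHLET FORM:** for a Perron sector amplitude `a` of `H(Δ)` and any real diagonal dressing `g`,
`⟨g a, H g a⟩ − E(M)‖g a‖² = ⅛ Σ_x Σ_y [x ∼ y] Σ_σ a(σ) a(σ ∘ swap x y) (g(σ) − g(σ ∘ swap x y))²`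
(double commutator `½⟨a,[g,[H,g]]a⟩`; the Dirichlet form of the Doob-transformed exclusion chain). [folklore] -/
theorem energyExcess_diag_eq_bond_sum {Δ M : ℝ} {a : TensorIndex (TorusSite 2 L) 2 → ℝ}
    (ha : IsPerronSectorGroundAmplitude L Δ M a) (g : TensorIndex (TorusSite 2 L) 2 → ℝ) :
    energyQ L Δ (fun σ => g σ * a σ) - sectorE L Δ M * ∑ σ, (g σ * a σ) ^ 2
      = (1/8 : ℝ) * ∑ x : TorusSite 2 L, ∑ y, if (torusGraph 2 L).Adj x y then
          ∑ σ, a σ * a (σ ∘ ⇑(Equiv.swap x y)) * (g σ - g (σ ∘ ⇑(Equiv.swap x y))) ^ 2 else 0 := by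
  -- the facts we need, stated before abbreviating (so that `set` folds them too)
  have eQ := energyQ_eq_real (L := L) Δ (fun σ => g σ * a σ)
  have hpe : ∀ σ, fmOp (torusGraph 2 L) a σ + (1 - Δ) * (isingW (torusGraph 2 L) σ * a σ)
      = (sectorE L Δ M + (1/8 : ℝ) * ∑ x : TorusSite 2 L, ∑ y, if (torusGraph 2 L).Adj x y then (1:ℝ) else 0) * a σ :=
    fun σ => by rw [sectorE_eq]; exact perron_eigen_real ha σ
  set G := torusGraph 2 L with hG
  set D : ℝ := ∑ x : TorusSite 2 L, ∑ y, if G.Adj x y then (1:ℝ) else 0 with hD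
  set E : ℝ := sectorE L Δ M with hE
  set ga : TensorIndex (TorusSite 2 L) 2 → ℝ := fun σ => g σ * a σ with hga
  have hgaσ : ∀ σ, ga σ = g σ * a σ := fun σ => rfl
  -- the eigen-equation, multiplied by `g(σ)² a(σ)`
  have heig : ∀ σ, (E + (1/8 : ℝ) * D) * (g σ * a σ) ^ 2
      = (g σ * a σ) * (g σ * fmOp G a σ) + (1 - Δ) * (isingW G σ * (g σ * a σ) ^ 2) := by
    intro σ
    calc (E + (1/8 : ℝ) * D) * (g σ * a σ) ^ 2
        = g σ ^ 2 * a σ * ((E + (1/8 : ℝ) * D) * a σ) := by ring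
      _ = g σ ^ 2 * a σ * (fmOp G a σ + (1 - Δ) * (isingW G σ * a σ)) := by rw [hpe σ]
      _ = _ := by ring
  -- excess in pointwise form
  have h1 : energyQ L Δ ga - E * ∑ σ, (g σ * a σ) ^ 2
      = ∑ σ, g σ * a σ * (fmOp G ga σ - g σ * fmOp G a σ) := by
    have step : energyQ L Δ ga - E * ∑ σ, (g σ * a σ) ^ 2
        = ∑ σ, (ga σ * (fmOp G ga σ + (1 - Δ) * (isingW G σ * ga σ))
            - (1/8 : ℝ) * D * ga σ ^ 2 - E * (g σ * a σ) ^ 2) := by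
      rw [Finset.sum_sub_distrib, Finset.sum_sub_distrib, ← Finset.mul_sum, ← Finset.mul_sum, ← eQ]
    rw [step]
    refine Finset.sum_congr rfl fun σ _ => ?_
    have := heig σ
    rw [hgaσ σ]
    linear_combination -this
  -- the commutator `A(g a) − g A a` pointwise
  have h2 : ∀ σ, fmOp G ga σ - g σ * fmOp G a σ
      = (1/4 : ℝ) * ∑ x, ∑ y, if G.Adj x y then
          a (σ ∘ ⇑(Equiv.swap x y)) * (g σ - g (σ ∘ ⇑(Equiv.swap x y))) else 0 := by
    intro σ
    unfold fmOp
    simp only [hgaσ]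
    rw [mul_left_comm, ← mul_sub, Finset.mul_sum, ← Finset.sum_sub_distrib]
    congr 1
    refine Finset.sum_congr rfl fun x _ => ?_
    rw [Finset.mul_sum, ← Finset.sum_sub_distrib]
    refine Finset.sum_congr rfl fun y _ => ?_
    by_cases h : G.Adj x y
    · rw [if_pos h, if_pos h, if_pos h]; ring
    · rw [if_neg h, if_neg h, if_neg h]; ring
  rw [h1]
  calc ∑ σ, g σ * a σ * (fmOp G ga σ - g σ * fmOp G a σ)
      = ∑ σ, (1/4 : ℝ) * ∑ x, ∑ y, if G.Adj x y then
          g σ * a σ * a (σ ∘ ⇑(Equiv.swap x y)) * (g σ - g (σ ∘ ⇑(Equiv.swap x y))) else 0 := by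
        refine Finset.sum_congr rfl fun σ _ => ?_
        rw [h2 σ, mul_left_comm, Finset.mul_sum]
        congr 1
        refine Finset.sum_congr rfl fun x _ => ?_
        rw [Finset.mul_sum]
        refine Finset.sum_congr rfl fun y _ => ?_
        by_cases h : G.Adj x y
        · rw [if_pos h, if_pos h]; ring
        · rw [if_neg h, if_neg h, mul_zero]
    _ = (1/4 : ℝ) * ∑ x, ∑ y, ∑ σ, if G.Adj x y then
          g σ * a σ * a (σ ∘ ⇑(Equiv.swap x y)) * (g σ - g (σ ∘ ⇑(Equiv.swap x y))) else 0 := by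
        rw [← Finset.mul_sum]
        congr 1
        rw [Finset.sum_comm]
        exact Finset.sum_congr rfl fun x _ => Finset.sum_comm
    _ = (1/4 : ℝ) * ∑ x, ∑ y, if G.Adj x y then
          (1/2 : ℝ) * ∑ σ, a σ * a (σ ∘ ⇑(Equiv.swap x y)) * (g σ - g (σ ∘ ⇑(Equiv.swap x y))) ^ 2 else 0 := by
        congr 1
        refine Finset.sum_congr rfl fun x _ => Finset.sum_congr rfl fun y _ => ?_
        by_cases h : G.Adj x y
        · simp only [if_pos h]
          exact sum_diag_hop_eq g a x y
        · simp only [if_neg h, Finset.sum_const_zero]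
    _ = (1/8 : ℝ) * ∑ x, ∑ y, if G.Adj x y then
          ∑ σ, a σ * a (σ ∘ ⇑(Equiv.swap x y)) * (g σ - g (σ ∘ ⇑(Equiv.swap x y))) ^ 2 else 0 := by
        rw [show (1/8 : ℝ) = (1/4 : ℝ) * (1/2 : ℝ) by norm_num, mul_assoc]
        congr 1
        symm
        rw [Finset.mul_sum]
        refine Finset.sum_congr rfl fun x _ => ?_
        rw [Finset.mul_sum]
        refine Finset.sum_congr rfl fun y _ => ?_
        by_cases h : G.Adj x y
        · rw [if_pos h, if_pos h]
        · rw [if_neg h, if_neg h, mul_zero]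

/-- an unbroken bond is fixed by the swap, so only broken bonds contribute: the bond term equals
`Σ_σ brk σ x y · a(σ)a(σ')(g σ − g σ')²`. [folklore] -/
theorem sum_diag_sq_eq_brk (g a : TensorIndex (TorusSite 2 L) 2 → ℝ) (x y : TorusSite 2 L) :
    ∑ σ, a σ * a (σ ∘ ⇑(Equiv.swap x y)) * (g σ - g (σ ∘ ⇑(Equiv.swap x y))) ^ 2
      = ∑ σ, brk σ x y * (a σ * a (σ ∘ ⇑(Equiv.swap x y)) * (g σ - g (σ ∘ ⇑(Equiv.swap x y))) ^ 2) := by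
  refine Finset.sum_congr rfl fun σ _ => ?_
  unfold brk
  by_cases h : σ x = σ y
  · rw [if_pos h, comp_swap_of_eq σ h]; ring
  · rw [if_neg h]; ring

/-- **the energy excess of a diagonally dressed Perron amplitude is non-negative.** [folklore] -/
theorem energyExcess_diag_nonneg {Δ M : ℝ} {a : TensorIndex (TorusSite 2 L) 2 → ℝ}
    (ha : IsPerronSectorGroundAmplitude L Δ M a) (g : TensorIndex (TorusSite 2 L) 2 → ℝ) :
    0 ≤ energyQ L Δ (fun σ => g σ * a σ) - sectorE L Δ M * ∑ σ, (g σ * a σ) ^ 2 := by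
  rw [energyExcess_diag_eq_bond_sum ha g]
  refine mul_nonneg (by norm_num) (Finset.sum_nonneg fun x _ => Finset.sum_nonneg fun y _ => ?_)
  split_ifs
  · exact Finset.sum_nonneg fun σ _ => mul_nonneg (mul_nonneg (ha.nonneg σ) (ha.nonneg _)) (sq_nonneg _)
  · exact le_rfl

/-- **bondwise Lipschitz bound:** if the dressing changes by at most `δ(x, y)` in square across every broken bond `(x, y)` of every
configuration, then `⟨g a,(H − E)g a⟩ ≤ ⅛ Σ_{x∼y} δ(x,y) · hopCorr a x y`. [folklore] -/
theorem energyExcess_diag_le_of_lipschitz {Δ M : ℝ} {a : TensorIndex (TorusSite 2 L) 2 → ℝ}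
    (ha : IsPerronSectorGroundAmplitude L Δ M a) (g : TensorIndex (TorusSite 2 L) 2 → ℝ) (δ : TorusSite 2 L → TorusSite 2 L → ℝ)
    (hδ : ∀ (x y : TorusSite 2 L) (σ : TensorIndex (TorusSite 2 L) 2), (torusGraph 2 L).Adj x y → σ x ≠ σ y →
      (g σ - g (σ ∘ ⇑(Equiv.swap x y))) ^ 2 ≤ δ x y) :
    energyQ L Δ (fun σ => g σ * a σ) - sectorE L Δ M * ∑ σ, (g σ * a σ) ^ 2
      ≤ (1/8 : ℝ) * ∑ x : TorusSite 2 L, ∑ y, if (torusGraph 2 L).Adj x y then δ x y * hopCorr a x y else 0 := by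
  rw [energyExcess_diag_eq_bond_sum ha g]
  refine mul_le_mul_of_nonneg_left (Finset.sum_le_sum fun x _ => Finset.sum_le_sum fun y _ => ?_) (by norm_num)
  by_cases hxy : (torusGraph 2 L).Adj x y
  · rw [if_pos hxy, if_pos hxy, sum_diag_sq_eq_brk]
    unfold hopCorr
    rw [Finset.mul_sum]
    refine Finset.sum_le_sum fun σ _ => ?_
    have h0 : 0 ≤ brk σ x y * (a σ * a (σ ∘ ⇑(Equiv.swap x y))) :=
      mul_nonneg (brk_nonneg σ x y) (mul_nonneg (ha.nonneg σ) (ha.nonneg _))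
    by_cases hb : σ x = σ y
    · have : brk σ x y = 0 := by unfold brk; rw [if_pos hb]
      rw [this]; simp
    · have hle := hδ x y σ hxy hb
      calc brk σ x y * (a σ * a (σ ∘ ⇑(Equiv.swap x y)) * (g σ - g (σ ∘ ⇑(Equiv.swap x y))) ^ 2)
          = (brk σ x y * (a σ * a (σ ∘ ⇑(Equiv.swap x y)))) * (g σ - g (σ ∘ ⇑(Equiv.swap x y))) ^ 2 := by ring
        _ ≤ (brk σ x y * (a σ * a (σ ∘ ⇑(Equiv.swap x y)))) * δ x y := mul_le_mul_of_nonneg_left hle h0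
        _ = δ x y * (brk σ x y * (a σ * a (σ ∘ ⇑(Equiv.swap x y)))) := by ring
  · rw [if_neg hxy, if_neg hxy]

end Summit.HubbardSuperconductivity.HubbardSuperconductivity.Theorems.AnisotropyChord.Transfer
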